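import Summits.ResolutionOfSingularities.ResolutionOfSingularities.Theorems.FrobeniusClosingSteerNonRationalWindowWords
import HarnessLib

/-!
# hH2′ / hNRAB — the W-NRA-B DICHOTOMY RE-CUT, words (res-L0-w41-plan-1 RULING 322 (i)): W-NRA-B′ `NonRationalBWindowsDichotomyTwoN`
  («binary OR uniaxial on-axis datum at late A-stages» under (B1)(B2)) and the window-free one-axis exclusion W-NRA-U′
  `UniaxialNotBinaryAStagesNotEternalTwoN`; the PROVED glue `nonRationalBWindowsTwoN_of_dichotomy : W-NRA-B′ → W-NRA-B` and `W-NRA-U′_holds` are the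
  theorem half `…NonRationalBWindowDichotomyGlue`

OURS (campaign `res-hironaka`, rung L ★L-G4, slot W4.1 · crux `Steer` (stmt-ResolutionOfSingularities-16345) · hARᵒ slot H2′ =
`ArithLeaf.LateSwitchBinaryAStageTwoN`, T-line binder hNRAB = `NonRationalBWindowsTwoN`; res-D-lib-1 g8 = the EtaleLift hand of RULINGs 316 (c) /
320 / 322). Candidates, not facts; nothing here is a statement of H. Hironakaʼs manuscript [claim: Hironaka2017, status: under-review]; AI-written, AI
review is weaker than expert review.

WHY THE RE-CUT (res-D-lib-1 CORRECTION 2026-08-27T22:07:43Z, accepted RULING 322 (b)). In the regime of W-NRA-B ((B1) late A-stage windows residually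
rational, (B2) residually NON-rational windows recur — hence at B-windows) the rational window kernels behind
`BinaryResidue.lateSwitchBinaryAStage_of_rationalWindows` are fed through adapted coordinates `𝔪_{S′} = (x, u′)`, `u = x·u′`, of the B-window, and such
coordinates FORCE residual rationality (the centre of `S′` is the `κ`-rational point `u′ = 0` of the exceptional divisor). After the étale residually
rational lift of the window (`EtaleLift.exists_rational_window_lift`, `EtaleTower.horizonBaseChange`) they exist UPSTAIRS, and F3/F4 upstairs put the two
linear forms `σ′, τ′` of the binary datum inside the hyperplane `Ū′ ⊂ 𝔪′/𝔪′²` of forms through ONE of the conjugate points into which the non-rational centre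
splits; `Ū′` is NOT `κ`-rational. Galois descent makes the essential-variable space `W_min(in_d F)` `κ`-rational and `⊆ ⋂_g g·Ū′ =: V₀` = {forms vanishing
at ALL conjugates of the centre}, `dim V₀ = 4 − r ≤ 2` (`r ≥ 2` = dimension of the span of the conjugate directions). Hence the DESCENDED datum at the
A-stage is a binary ON-AXIS datum (when `dim V₀ = 2`) OR DEGENERATES to a UNIAXIAL one `c·m^d`, `m` spanning the `κ`-rational line `V₀` — the bi-cone /
uniaxial phenomenon of W-NRA-A / W-NRA-U, now at the B-window. So the honest run-level residual of W-NRA-B is NOT hH2′ʼs binary conclusion but the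
DICHOTOMY below, and the uniaxial branch is excluded at run level by the one-axis H3 kernel `H3OneAxisTwoN` (PROVED, `h3OneAxisTwoN_holds` p571187)
exactly as for W-NRA-U — whose proof `uniaxialAStagesNotEternal_of_H3oneAxis` never used the window / non-rationality conjunct, whence W-NRA-U′.
* **W-NRA-B′ `NonRationalBWindowsDichotomyTwoN`** — W-NRA-Bʼs binder telescope VERBATIM (hH2′ʼs binders, (B1), (B2)) ⇒ beyond every stage an
  A-STAGE `i` and `u : K` with `BinaryAxisDatumAt O R P s p i d u ∨ UniaxialDatumAt O R P s p i d u` (both datum predicates already say «`u`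
  exceptional at `i`»). OPEN — the target of the EtaleLift programme: (P2)(P3) «upstairs binary datum at the base-changed B-window» (needs a
  VALUATION-FREE `BinaryResidue.exists_adapted_window` upstairs: inputs `IsQuadraticTransform S′₀ S′₁`, K3-b `span_image_maximalIdeal_of_levelLift`,
  `IsResiduallyRational`) and (P4′) = RULING 322 (i)ʼs `BDatumDescentOrUniaxialTwoN` «descent with degeneration: binary-in-`V₀` OR uniaxial along
  `V₀`» — NOT typed in this file (typing the upstairs window objects before the valuation-free adapted-window lemma exists is how the vacuous
  scratch f776427f73106291 arose; the run-level dichotomy is the interface both must meet, and it is certainly the right one for the glue).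
* **W-NRA-U′ `UniaxialNotBinaryAStagesNotEternalTwoN`** — W-NRA-Uʼs binder telescope VERBATIM; conclusion = W-NRA-Uʼs with the window conjunct
  `∃ i′, IsVisitPair R P i i′ ∧ ¬(window rational)` DROPPED: A-stages carrying the uniaxial and not the binary datum (same `u`) do not recur beyond every
  stage. PROVED in the Glue file from `H3OneAxisTwoN` (proof text of `uniaxialAStagesNotEternal_of_H3oneAxis` verbatim up to the destructuring line).
⇒ (Glue file) **hNRAB = CLOSED-MODULO {W-NRA-B′}**, 1 ↦ 1 BY NAME: `lateSwitchBinaryAStage_of_A_B hW (nonRationalBWindowsTwoN_of_dichotomy hBD)`.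
[invented: ours] [cite: Matsumura1987, Thm. 14.2] [folklore]
-/

-- `Summit.<S>.<S>.…` duplicates the summit name by design (single-problem summit).
set_option linter.dupNamespace false

open IsLocalRing
open Literature.AlgebraicGeometry.Resolution
open Summit.ResolutionOfSingularities.ResolutionOfSingularities.Theorems.SwitchingDichotomy.Words
open Summit.ResolutionOfSingularities.ResolutionOfSingularities.Theorems.SteerRankThinness (Concl HasProperCoarsening)
open Summit.ResolutionOfSingularities.ResolutionOfSingularities.Theorems.SwitchingDichotomy.ArithReduction
open Summit.ResolutionOfSingularities.ResolutionOfSingularities.Theorems.SwitchingDichotomy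

namespace Summit.ResolutionOfSingularities.ResolutionOfSingularities.Theorems.SwitchingDichotomy.NonRationalWindow

/-- **W-NRA-B′ · `NonRationalBWindowsDichotomyTwoN`** (OPEN; res-D-lib-1 g8 re-cut of W-NRA-B, RULING 322 (b)/(i)): the binder telescope of
`NonRationalBWindowsTwoN` VERBATIM — hH2′ʼs binders, (B1) «from some stage on every A-STAGE window is residually rational (value form)», (B2)
«residually NON-rational windows recur beyond every stage» — and the conclusion WEAKENED to the dichotomy: beyond every stage there is an A-STAGE `i`
of the reduced order `d` and `u : K` carrying the on-axis BINARY datum `BinaryAxisDatumAt O R P s p i d u` OR the UNIAXIAL datum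
`UniaxialDatumAt O R P s p i d u` (each predicate contains «`u` exceptional at `i`»). This is what the étale-lift route delivers honestly (module
docstring: upstairs F3/F4 at the residually rational lift of the B-window, then Galois descent WITH DEGENERATION — `W_min ⊆ V₀`, `dim V₀ ≤ 2`); the
uniaxial branch is killed at run level by `UniaxialNotBinaryAStagesNotEternalTwoN` (PROVED from `H3OneAxisTwoN`), so that
`nonRationalBWindowsTwoN_of_dichotomy : NonRationalBWindowsDichotomyTwoN → NonRationalBWindowsTwoN` (Glue file, PROVED). Why it might still fail: it
is the genuine residual of hH2′ in the (B1)(B2) regime — a run whose late A-stage data all come from non-rational B-windows with `dim V₀ ≤ 1` AND whose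
uniaxial stages evade… nothing: the uniaxial branch is refuted by H3, so a failure of W-NRA-B′ is a failure of the descent dichotomy itself (e.g.
`W_min ⊄ V₀` because the upstairs datum is not the F3 one). OURS. [invented: ours] (folklore) -/
def NonRationalBWindowsDichotomyTwoN : Prop :=
  ∀ p : ℕ, p = 2 →
    ∀ (k K : Type) [Field k] [CharP k p] [PerfectField k] [Field K] [Algebra k K]
    (O : ValuationSubring K) (A₀ : Subalgebra k K) (h₀ : A₀.toSubring ≤ O.toSubring) (t : K),
    CoreDatum p 4 k K O A₀ h₀ t → ¬ HasProperCoarsening O →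
    ∀ (R : ℕ → Subring K) (P : (i : ℕ) → Ideal (R i)) (s : ℕ → K),
      R 0 = locAtCentre A₀.toSubring O → NormalAt O (R 0) p t → IsSteeredRun O R P t p s →
      (¬ ∃ i₀ c : ℕ, 1 ≤ c ∧ IsDominantTail R P i₀ c) →
      (∃ i₀ : ℕ, ∀ i, i₀ ≤ i → IsHighOrderAt R s p i) →
      ¬ HeightTwoStepsInfinite R P → {j | IsPosStep R P j}.Infinite →
      (∀ i₀ : ℕ, ∃ i, i₀ ≤ i ∧ IsPointStep R P i ∧
        ∀ hs : s i ^ p ∈ R i, ¬ HasIsolatedSingularity (RadicandRing (R i) p ⟨s i ^ p, hs⟩)) →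
      (¬ ∃ i₀ : ℕ, ∃ x : K, x ≠ 0 ∧ x ∈ O ∧ O.valuation x < 1 ∧
        ∀ i, i₀ ≤ i → ∀ y ∈ R i, O.valuation y < 1 → ∃ j, i < j ∧ y / x ∈ R j) →
      (∀ i₀ : ℕ, ∃ i, i₀ ≤ i ∧ OddCleanedPointStepAt R P s p i) →
      (∀ i, IsRegularLocalRing (R i)) → (∀ i, ringKrullDim (R i) = (4 : ℕ)) →
      ∀ N₁ : ℕ,
      (∀ j, N₁ ≤ j → IsPointStep R P j → ∀ (hs' : s j ^ p ∈ R j) (Q : Ideal (R j)) [Q.IsPrime], Q.height = 0 →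
          ¬ SigmaTopLegality.IsSingPrime (R j) p ⟨s j ^ p, hs'⟩ Q) →
      (∀ j, N₁ ≤ j → IsPointStep R P j → ∀ (hs' : s j ^ p ∈ R j) (Q : Ideal (R j)) [Q.IsPrime], Q.height = 1 →
          ¬ SigmaTopLegality.IsSingPrime (R j) p ⟨s j ^ p, hs'⟩ Q) →
      (∀ (j j' : ℕ) (x : K), N₁ ≤ j → IsVisitPair R P j j' →
        ((∃ h : x ∈ R j, (⟨x, h⟩ : R j) ∈ P j) ∧ x ≠ 0 ∧ ∀ y : R j, y ∈ P j → O.valuation (y : K) ≤ O.valuation x) →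
        ∀ l, j < l → l < j' → ∃ hx : x ∈ R l, P l = Ideal.span {(⟨x, hx⟩ : R l)}) →
      ∀ (d i₁ : ℕ), Odd d → 3 ≤ d →
      (∀ i, i₁ ≤ i → IsPointStep R P i → HasReducedOrderAt R s p i d) →
      (∀ i₀, ∃ i, i₀ ≤ i ∧ IsAStageAt R P s p i d) →
      -- (B1) from some stage on, every A-STAGE window is residually rational (value form)
      (∃ i₀ : ℕ, ∀ i i' : ℕ, i₀ ≤ i → IsAStageAt R P s p i d → IsVisitPair R P i i' →
          ∀ a ∈ R i', ∃ b ∈ R i, O.valuation (a - b) < 1) →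
      -- (B2) residually NON-rational windows recur beyond every stage (value form, verbatim negation of the rational binder)
      (∀ N : ℕ, ∃ j j' : ℕ, N ≤ j ∧ IsVisitPair R P j j' ∧ ¬ ∀ a ∈ R j', ∃ b ∈ R j, O.valuation (a - b) < 1) →

      ∀ i₀ : ℕ, ∃ i, i₀ ≤ i ∧ IsAStageAt R P s p i d ∧
        ∃ u : K, BinaryAxisDatumAt O R P s p i d u ∨ UniaxialDatumAt O R P s p i d u

/-- **W-NRA-U′ · `UniaxialNotBinaryAStagesNotEternalTwoN`** (window-free form of W-NRA-U `UniaxialAStagesNotEternalTwoN`): the SAME binder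
telescope (hH2′ʼs binders verbatim), and the conclusion with the window conjunct `∃ i′, IsVisitPair R P i i′ ∧ ¬(∀ a ∈ R i′, ∃ b ∈ R i, v(a − b) < 1)`
DROPPED: A-STAGES `i` carrying, for some `u : K`, the uniaxial datum `UniaxialDatumAt O R P s p i d u` and NOT the binary datum
`BinaryAxisDatumAt O R P s p i d u` do NOT recur beyond every stage. PROVED (Glue file `uniaxialNotBinaryAStagesNotEternal_of_H3oneAxis`,
`…_holds`): the one-axis H3 kernel turns a late uniaxial on-axis A-stage into a later positive step of height ≥ 2, excluded beyond the
`¬ HeightTwoStepsInfinite` bound — the window played no rôle in that argument. Consumer: the uniaxial branch of W-NRA-B′. OURS. [invented: ours]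
(folklore) -/
def UniaxialNotBinaryAStagesNotEternalTwoN : Prop :=
  ∀ p : ℕ, p = 2 →
    ∀ (k K : Type) [Field k] [CharP k p] [PerfectField k] [Field K] [Algebra k K]
    (O : ValuationSubring K) (A₀ : Subalgebra k K) (h₀ : A₀.toSubring ≤ O.toSubring) (t : K),
    CoreDatum p 4 k K O A₀ h₀ t → ¬ HasProperCoarsening O →
    ∀ (R : ℕ → Subring K) (P : (i : ℕ) → Ideal (R i)) (s : ℕ → K),
      R 0 = locAtCentre A₀.toSubring O → NormalAt O (R 0) p t → IsSteeredRun O R P t p s →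
      (¬ ∃ i₀ c : ℕ, 1 ≤ c ∧ IsDominantTail R P i₀ c) →
      (∃ i₀ : ℕ, ∀ i, i₀ ≤ i → IsHighOrderAt R s p i) →
      ¬ HeightTwoStepsInfinite R P → {j | IsPosStep R P j}.Infinite →
      (∀ i₀ : ℕ, ∃ i, i₀ ≤ i ∧ IsPointStep R P i ∧
        ∀ hs : s i ^ p ∈ R i, ¬ HasIsolatedSingularity (RadicandRing (R i) p ⟨s i ^ p, hs⟩)) →
      (¬ ∃ i₀ : ℕ, ∃ x : K, x ≠ 0 ∧ x ∈ O ∧ O.valuation x < 1 ∧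
        ∀ i, i₀ ≤ i → ∀ y ∈ R i, O.valuation y < 1 → ∃ j, i < j ∧ y / x ∈ R j) →
      (∀ i₀ : ℕ, ∃ i, i₀ ≤ i ∧ OddCleanedPointStepAt R P s p i) →
      (∀ i, IsRegularLocalRing (R i)) → (∀ i, ringKrullDim (R i) = (4 : ℕ)) →
      ∀ N₁ : ℕ,
      (∀ j, N₁ ≤ j → IsPointStep R P j → ∀ (hs' : s j ^ p ∈ R j) (Q : Ideal (R j)) [Q.IsPrime], Q.height = 0 →
          ¬ SigmaTopLegality.IsSingPrime (R j) p ⟨s j ^ p, hs'⟩ Q) →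
      (∀ j, N₁ ≤ j → IsPointStep R P j → ∀ (hs' : s j ^ p ∈ R j) (Q : Ideal (R j)) [Q.IsPrime], Q.height = 1 →
          ¬ SigmaTopLegality.IsSingPrime (R j) p ⟨s j ^ p, hs'⟩ Q) →
      (∀ (j j' : ℕ) (x : K), N₁ ≤ j → IsVisitPair R P j j' →
        ((∃ h : x ∈ R j, (⟨x, h⟩ : R j) ∈ P j) ∧ x ≠ 0 ∧ ∀ y : R j, y ∈ P j → O.valuation (y : K) ≤ O.valuation x) →
        ∀ l, j < l → l < j' → ∃ hx : x ∈ R l, P l = Ideal.span {(⟨x, hx⟩ : R l)}) →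
      ∀ (d i₁ : ℕ), Odd d → 3 ≤ d →
      (∀ i, i₁ ≤ i → IsPointStep R P i → HasReducedOrderAt R s p i d) →
      (∀ i₀, ∃ i, i₀ ≤ i ∧ IsAStageAt R P s p i d) →

      ¬ (∀ i₀ : ℕ, ∃ i, i₀ ≤ i ∧ IsAStageAt R P s p i d ∧
          ∃ u : K, UniaxialDatumAt O R P s p i d u ∧ ¬ BinaryAxisDatumAt O R P s p i d u)

end Summit.ResolutionOfSingularities.ResolutionOfSingularities.Theorems.SwitchingDichotomy.NonRationalWindow
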